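import Summits.ResolutionOfSingularities.ResolutionOfSingularities.Theorems.EquisingularLiftEquisingularLiftNatNDStrataTower
import HarnessLib

/-!
# [OURS · L1 W4.5(b) · EL♮(3) · SPEC K6 v10 — THE JUNCTION, TYPED AHEAD OF THE TEXTS] the collapsed motive `Q₃ := ∃ Ls Mp, Q … Ls Mp`

res-L1-w45b-idea-1 g27 (IDEATOR 1; SPEC custody) · 2026-08-28 · companion of `Cruxes/EquisingularLiftNatThree/SPEC-K6-v10-PLAN.md` dd8614218a1b6d17 §3
«JUNCTION (the one new line)».  OURS · counted 0 · AI-written, weaker than expert review · nothing of [Hironaka2017] asserted · **EL♮(3) NOT proved** —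
pure logic over the tree's `ND.RoundClosed` / `ND.ReachToric` (…NatNDStrataTower §13.9); no `sorry`, no instance, no notation.

WHAT.  K6-2P / K6-2P5 glue the PREFIX reach (`hpre : ∀ Q, START → clauses → Q F ρ T`) to the ND rounds (`hQ' : ∀ Q₃, ND.RoundClosed n k Q₃ → Q₃ F ρ T → Q₃ F' ρ' T'`,
from ✓ `ND.rounds_resolve`) with the SAME motive `Q` (arity 3).  In the widened prefix of WIDTH TABLE D5 the engine's motive has arity 5,
`Q F ρ T (Ls : Λ F) (Mp : Ψ F)` (letters list and the `Option`-guarded pre-letter slot — kept ABSTRACT here: any slot types `Λ Ψ : Scheme → Type` with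
designated trivial slots `l₀ F : Λ F`, `p₀ F : Ψ F`, i.e. `[]` and `none`), and its END / the prefix's conclusion are EXISTENTIAL in the slots (027 C3).
The junction is then ONE application of `hQ'` to the COLLAPSED motive `collapse Q := fun F ρ T => ∃ Ls Mp, Q F ρ T Ls Mp`, whose `ND.RoundClosed`ness
follows from the engine's letter-DROPPING point-step-and-reach clause (stub-2 (β)/(R): general premise `Q F₁ ρ T₁ Ls Mp`, conclusions at the trivial
slots) restricted to toric towers (`Or.inr` when the engine's reach is `B‴ ∨ toric`; here any `Reach ⊇ ND.ReachToric n`).  This file TYPE-CHECKS that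
claim once and for all, independent of the texts still being written (K5⁶ `hres`, Defs8): `RoundClosed6`, `roundClosed_collapse`, `junction6`.
-/

set_option linter.dupNamespace false -- mandated namespace of this single-conjunct summit

noncomputable section

open CategoryTheory CategoryTheory.Limits AlgebraicGeometry TopologicalSpace Topology
open Summit.ResolutionOfSingularities.ResolutionOfSingularities.Cruxes.EquisingularLiftNat.Sections

namespace Summit.ResolutionOfSingularities.ResolutionOfSingularities.Cruxes.EquisingularLiftNatThree.ToricTowers.K6Junction

variable (n : ℕ) (k : Type) [Field k]

/-- The COLLAPSED motive: forget the slots existentially. [OURS · definition, pure logic] -/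
def collapse {Λ Ψ : Scheme.{0} → Type}
    (Q : ∀ F₁ : Scheme.{0}, (F₁ ⟶ (Literature.AlgebraicGeometry.Motives.projectiveSpace n k).left) → Set F₁ → Λ F₁ → Ψ F₁ → Prop) :
    ∀ F₁ : Scheme.{0}, (F₁ ⟶ (Literature.AlgebraicGeometry.Motives.projectiveSpace n k).left) → Set F₁ → Prop :=
  fun F₁ ρ T₁ => ∃ (Ls : Λ F₁) (Mp : Ψ F₁), Q F₁ ρ T₁ Ls Mp

/-- **`RoundClosed6 Reach l₀ p₀ Q`** — the arity-5 motive is closed under «ND point step (a non-regular closed point of the reduced closure, ambient regular, any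
blow-up of it), then every `Reach` tower after it», with a GENERAL slot premise `Q F₁ ρ T₁ Ls Mp` and conclusions AT THE TRIVIAL SLOTS `l₀`, `p₀` (letters and
pre-letter DROPPED through towers — stub-2 (β)).  = the tree's `ND.RoundClosed` body VERBATIM with the two slot binders added and `Reach` in place of
`ND.ReachToric n`.  This is the shape SPEC K6 v10 §3 (R2) asks the K5⁶ `hres` reach clause to have (read off by `Or.inr` when `Reach := B‴ ∨ toric`).
[OURS · definition] -/
def RoundClosed6 {Λ Ψ : Scheme.{0} → Type}
    (Reach : ∀ (F₁ F₂ : Scheme.{0}), (F₂ ⟶ F₁) → F₁ → Set F₂ → ∀ (F₉ : Scheme.{0}), (F₉ ⟶ F₂) → Set F₉ → Prop)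
    (l₀ : ∀ F₁ : Scheme.{0}, Λ F₁) (p₀ : ∀ F₁ : Scheme.{0}, Ψ F₁)
    (Q : ∀ F₁ : Scheme.{0}, (F₁ ⟶ (Literature.AlgebraicGeometry.Motives.projectiveSpace n k).left) → Set F₁ → Λ F₁ → Ψ F₁ → Prop) : Prop :=
  ∀ (F₁ F₂ : AlgebraicGeometry.Scheme.{0}) (ρ : F₁ ⟶ (Literature.AlgebraicGeometry.Motives.projectiveSpace n k).left)
            (T₁ : Set F₁)
            (x : ↥(AlgebraicGeometry.Scheme.IdealSheafData.vanishingIdeal (⟨closure T₁, isClosed_closure⟩ : TopologicalSpace.Closeds F₁)).subscheme)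
            (υ : F₂ ⟶ F₁)
            (hx : IsClosed ({((AlgebraicGeometry.Scheme.IdealSheafData.vanishingIdeal (⟨closure T₁, isClosed_closure⟩ : TopologicalSpace.Closeds F₁)).subschemeι x : F₁)} : Set F₁))
            (Ls : Λ F₁) (Mp : Ψ F₁),
          Q F₁ ρ T₁ Ls Mp →
          ¬ IsRegularLocalRing ((AlgebraicGeometry.Scheme.IdealSheafData.vanishingIdeal (⟨closure T₁, isClosed_closure⟩ : TopologicalSpace.Closeds F₁)).subscheme.presheaf.stalk x) →
          IsRegularLocalRing (F₁.presheaf.stalk ((AlgebraicGeometry.Scheme.IdealSheafData.vanishingIdeal (⟨closure T₁, isClosed_closure⟩ : TopologicalSpace.Closeds F₁)).subschemeι x : F₁)) →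
          Literature.AlgebraicGeometry.Resolution.IsBlowup υ
            (AlgebraicGeometry.Scheme.IdealSheafData.vanishingIdeal (⟨{((AlgebraicGeometry.Scheme.IdealSheafData.vanishingIdeal (⟨closure T₁, isClosed_closure⟩ : TopologicalSpace.Closeds F₁)).subschemeι x : F₁)}, hx⟩ : TopologicalSpace.Closeds F₁)) →
          Q F₂ (υ ≫ ρ) (closure (υ ⁻¹' (T₁ \ {((AlgebraicGeometry.Scheme.IdealSheafData.vanishingIdeal (⟨closure T₁, isClosed_closure⟩ : TopologicalSpace.Closeds F₁)).subschemeι x : F₁)}))) (l₀ F₂) (p₀ F₂) ∧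
          (∀ (F₉ : AlgebraicGeometry.Scheme.{0}) (β : F₉ ⟶ F₂) (T₉ : Set F₉),
            Reach F₁ F₂ υ ((AlgebraicGeometry.Scheme.IdealSheafData.vanishingIdeal (⟨closure T₁, isClosed_closure⟩ : TopologicalSpace.Closeds F₁)).subschemeι x : F₁) (closure (υ ⁻¹' (T₁ \ {((AlgebraicGeometry.Scheme.IdealSheafData.vanishingIdeal (⟨closure T₁, isClosed_closure⟩ : TopologicalSpace.Closeds F₁)).subschemeι x : F₁)}))) F₉ β T₉ →
            Q F₉ ((β ≫ υ) ≫ ρ) T₉ (l₀ F₉) (p₀ F₉))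

variable {n k}

/-- **The collapsed motive is `ND.RoundClosed`** as soon as the arity-5 motive is `RoundClosed6` for a reach containing the toric towers. [OURS · pure logic] -/
theorem roundClosed_collapse {Λ Ψ : Scheme.{0} → Type}
    {Reach : ∀ (F₁ F₂ : Scheme.{0}), (F₂ ⟶ F₁) → F₁ → Set F₂ → ∀ (F₉ : Scheme.{0}), (F₉ ⟶ F₂) → Set F₉ → Prop}
    (hRT : ∀ (F₁ F₂ : Scheme.{0}) (υ : F₂ ⟶ F₁) (x : F₁) (T₂ : Set F₂) (F₉ : Scheme.{0}) (β : F₉ ⟶ F₂) (T₉ : Set F₉),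
      ND.ReachToric n F₁ F₂ υ x T₂ F₉ β T₉ → Reach F₁ F₂ υ x T₂ F₉ β T₉)
    {l₀ : ∀ F₁ : Scheme.{0}, Λ F₁} {p₀ : ∀ F₁ : Scheme.{0}, Ψ F₁}
    {Q : ∀ F₁ : Scheme.{0}, (F₁ ⟶ (Literature.AlgebraicGeometry.Motives.projectiveSpace n k).left) → Set F₁ → Λ F₁ → Ψ F₁ → Prop}
    (hR6 : RoundClosed6 n k Reach l₀ p₀ Q) : ND.RoundClosed n k (collapse n k Q) := by
  intro F₁ F₂ ρ T₁ x υ hx hQ hn hr hυ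
  obtain ⟨Ls, Mp, hQ⟩ := hQ
  obtain ⟨h₁, h₂⟩ := hR6 F₁ F₂ ρ T₁ x υ hx Ls Mp hQ hn hr hυ
  exact ⟨⟨l₀ F₂, p₀ F₂, h₁⟩, fun F₉ β T₉ hR => ⟨l₀ F₉, p₀ F₉, h₂ F₉ β T₉ (hRT _ _ _ _ _ _ _ _ hR)⟩⟩

/-- **`junction6` — THE JUNCTION OF SPEC K6 v10 (§3).**  From the ND rounds' motive-level reach `hQ'` (✓ `ND.rounds_resolve`'s first conjunct, at the prefix's END
stage `(F, ρ, T)` towards the resolved end `(F', ρ', T')`), the engine's letter-dropping round closure `hR6` of the arity-5 motive, and the PREFIX's conclusion in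
the C3 form `∃ Ls Mp, Q F ρ T Ls Mp`: the END form `∃ Ls Mp, Q F' ρ' T' Ls Mp` the K5⁶ engine's final hypothesis consumes. [OURS · pure logic] -/
theorem junction6 {Λ Ψ : Scheme.{0} → Type}
    {Reach : ∀ (F₁ F₂ : Scheme.{0}), (F₂ ⟶ F₁) → F₁ → Set F₂ → ∀ (F₉ : Scheme.{0}), (F₉ ⟶ F₂) → Set F₉ → Prop}
    (hRT : ∀ (F₁ F₂ : Scheme.{0}) (υ : F₂ ⟶ F₁) (x : F₁) (T₂ : Set F₂) (F₉ : Scheme.{0}) (β : F₉ ⟶ F₂) (T₉ : Set F₉),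
      ND.ReachToric n F₁ F₂ υ x T₂ F₉ β T₉ → Reach F₁ F₂ υ x T₂ F₉ β T₉)
    {l₀ : ∀ F₁ : Scheme.{0}, Λ F₁} {p₀ : ∀ F₁ : Scheme.{0}, Ψ F₁}
    {Q : ∀ F₁ : Scheme.{0}, (F₁ ⟶ (Literature.AlgebraicGeometry.Motives.projectiveSpace n k).left) → Set F₁ → Λ F₁ → Ψ F₁ → Prop}
    (hR6 : RoundClosed6 n k Reach l₀ p₀ Q)
    {F F' : Scheme.{0}} {ρ : F ⟶ (Literature.AlgebraicGeometry.Motives.projectiveSpace n k).left} {T : Set F}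
    {ρ' : F' ⟶ (Literature.AlgebraicGeometry.Motives.projectiveSpace n k).left} {T' : Set F'}
    (hQ' : ∀ Q₃ : (∀ F₁ : Scheme.{0}, (F₁ ⟶ (Literature.AlgebraicGeometry.Motives.projectiveSpace n k).left) → Set F₁ → Prop),
      ND.RoundClosed n k Q₃ → Q₃ F ρ T → Q₃ F' ρ' T')
    (hstart : ∃ (Ls : Λ F) (Mp : Ψ F), Q F ρ T Ls Mp) :
    ∃ (Ls : Λ F') (Mp : Ψ F'), Q F' ρ' T' Ls Mp :=
  hQ' (collapse n k Q) (roundClosed_collapse hRT hR6) hstart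

/-- The `B‴ ∨ toric` instance of `hRT` used by K6-2P / K6-2P5 / K6-2P6 (`Or.inr`). [OURS · pure logic] -/
theorem reachToric_le_or
    (ReachB : ∀ (F₁ F₂ : Scheme.{0}), (F₂ ⟶ F₁) → F₁ → Set F₂ → ∀ (F₉ : Scheme.{0}), (F₉ ⟶ F₂) → Set F₉ → Prop) :
    ∀ (F₁ F₂ : Scheme.{0}) (υ : F₂ ⟶ F₁) (x : F₁) (T₂ : Set F₂) (F₉ : Scheme.{0}) (β : F₉ ⟶ F₂) (T₉ : Set F₉),
      ND.ReachToric n F₁ F₂ υ x T₂ F₉ β T₉ → (ReachB F₁ F₂ υ x T₂ F₉ β T₉ ∨ ND.ReachToric n F₁ F₂ υ x T₂ F₉ β T₉) :=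
  fun _ _ _ _ _ _ _ _ h => Or.inr h

/-- SANITY (the arity-3 case is recovered): with unit slots the collapsed motive of `fun F ρ T _ _ => Q₃ F ρ T` is equivalent to `Q₃`. [OURS · pure logic] -/
theorem collapse_const (Q₃ : ∀ F₁ : Scheme.{0}, (F₁ ⟶ (Literature.AlgebraicGeometry.Motives.projectiveSpace n k).left) → Set F₁ → Prop)
    (F₁ : Scheme.{0}) (ρ : F₁ ⟶ (Literature.AlgebraicGeometry.Motives.projectiveSpace n k).left) (T₁ : Set F₁) :
    collapse n k (Λ := fun _ => Unit) (Ψ := fun _ => Unit) (fun F ρ T _ _ => Q₃ F ρ T) F₁ ρ T₁ ↔ Q₃ F₁ ρ T₁ :=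
  ⟨fun ⟨_, _, h⟩ => h, fun h => ⟨(), (), h⟩⟩

end Summit.ResolutionOfSingularities.ResolutionOfSingularities.Cruxes.EquisingularLiftNatThree.ToricTowers.K6Junction

end
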